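import Mathlib.CategoryTheory.Limits.Preserves.Shapes.Products
import Mathlib.CategoryTheory.Limits.Preserves.Finite
import Mathlib.CategoryTheory.Galois.Decomposition
import Literature.AnabelianGeometry.SemiGraphs.GraphOfAnabelioidsComplements
import Literature.AnabelianGeometry.SemiGraphs.GraphOfAnabelioidsGalois
import Literature.AnabelianGeometry.Anabelioids.ComponentsOrbits
import Literature.AnabelianGeometry.Anabelioids.TrivialObjectCard
import HarnessLib

/-!
# The `ℤ/M`-twisted object of `B(𝒢)` along a component of an edge object ([SemiAnbd] Prop. 2.6, p. 29)

Mochizuki, *Semi-graphs of anabelioids*, Publ. RIMS **42** (2006), proof of Proposition 2.6,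
author's manuscript p. 29 [cite: MochizukiSemiAnbd2006, Prop. 2.6 p.29]: for a pair of distinct
coverticial edges the print passes to cyclic coverings of arbitrarily large degree `M`, connected over
`ℍ` and trivial over `𝕂`.  This file builds the PUSH-FORWARD of that cyclic covering along a finite
étale covering `𝒢' → 𝒢` attached to `A ∈ B(𝒢)`, directly downstairs (abc-iut-L6-t18, sub-node P26-R,
dictionary-free edge descent; pattern of abc-iut-L3-d1's `coveringObj`): for `A ∈ B(𝒢)`, a branch
`b₀` of an edge `e` and a mono `q : Q ↪ A_e` (a connected component of the edge object),

* `TwistedCovering.twistAut q M` — the automorphism of `∐_{ℤ/M} A_e` shifting the `Q`-summands by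
  `+1` and fixing the complement (axiom (G3) of Galois categories gives `A_e = Q ⨿ R`);
* `twistedObj A b₀ q M ∈ B(𝒢)` — `ℤ/M` copies of `A` constituentwise, glued as `A` is, except that at
  the branch `b₀` the gluing is followed by `twistAut` (REDUCIBLE, so that its constituents compute);
* `levelIncl` — over a sub-semi-graph `𝕂 ∌ e` the level inclusions `A|_𝕂 ⟶ Z_M|_𝕂` are morphisms;
* the `𝕂`-side of the descent: every orbit of (any transport / conjugate of) `Π_𝕂` on a fibre of
  `Z_M` has at most `deg A` points (`card_orbit_piK_twistedObj_le`, `card_orbit_conj_le`), and the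
  orbit count `card_orbit_le_relIndex_mul`; generic Galois-category tools (`exists_eq_map_ι`,
  `exists_lift_of_mono`, `level_eq_of_map_ι_eq`).

The `ℍ`-side (level chain) is `TwistedCoveringChain.lean`; the descent itself is
`CoverticialEdgeDescent.lean`.  Nothing here takes a side on [IUTchIII] Cor. 3.12.
-/

namespace Literature.AnabelianGeometry.SemiGraphs

open CategoryTheory CategoryTheory.Limits CategoryTheory.PreGaloisCategory

universe v₁ u₁ u

namespace TwistedCovering

variable {C : Type u₁} [Category.{v₁} C] [PreGaloisCategory C] {X T : C} (t : T ⟶ X) [Mono t]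
  (M : ℕ) [NeZero M]

/-- A complement of the mono `t : T ↪ X` (axiom (G3) of a Galois category): an object `R`. [cite: SGA1, Exp. V §5] -/
noncomputable def complObj : C := (PreGaloisCategory.monoInducesIsoOnDirectSummand t).choose

/-- The complement inclusion `R ⟶ X`. [cite: SGA1, Exp. V §5] -/
noncomputable def complHom : complObj t ⟶ X :=
  (PreGaloisCategory.monoInducesIsoOnDirectSummand t).choose_spec.choose

/-- `X = T ⨿ R`. [cite: SGA1, Exp. V §5] -/
noncomputable def complIsColimit : IsColimit (BinaryCofan.mk t (complHom t)) :=
  (PreGaloisCategory.monoInducesIsoOnDirectSummand t).choose_spec.choose_spec.some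

/-- The level shift by `k` on the `T`-summands of `∐_{ℤ/M} X`, identity on the complement. [cite: MochizukiSemiAnbd2006, Prop. 2.6 p.29] -/
noncomputable def twistMap (k : ZMod M) :
    (∐ fun _ : ZMod M => X) ⟶ ∐ fun _ : ZMod M => X :=
  Sigma.desc fun i => (complIsColimit t).desc
    (BinaryCofan.mk (t ≫ Sigma.ι (fun _ : ZMod M => X) (i + k))
      (complHom t ≫ Sigma.ι (fun _ : ZMod M => X) i))

/-- The twist shifts the `T`-summands: level `i` goes to level `i + k`. [cite: MochizukiSemiAnbd2006, Prop. 2.6 p.29] -/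
@[reassoc]
theorem t_ι_twistMap (k i : ZMod M) :
    t ≫ Sigma.ι (fun _ : ZMod M => X) i ≫ twistMap t M k =
      t ≫ Sigma.ι (fun _ : ZMod M => X) (i + k) := by
  unfold twistMap
  rw [Sigma.ι_desc]
  exact (complIsColimit t).fac _ ⟨WalkingPair.left⟩

/-- The twist fixes the complement summands. [cite: MochizukiSemiAnbd2006, Prop. 2.6 p.29] -/
@[reassoc]
theorem compl_ι_twistMap (k i : ZMod M) :
    complHom t ≫ Sigma.ι (fun _ : ZMod M => X) i ≫ twistMap t M k =
      complHom t ≫ Sigma.ι (fun _ : ZMod M => X) i := by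
  unfold twistMap
  rw [Sigma.ι_desc]
  exact (complIsColimit t).fac _ ⟨WalkingPair.right⟩

/-- Twists compose additively. [cite: MochizukiSemiAnbd2006, Prop. 2.6 p.29] -/
theorem twistMap_comp (k k' : ZMod M) :
    twistMap t M k ≫ twistMap t M k' = twistMap t M (k + k') := by
  apply Sigma.hom_ext
  intro i
  apply BinaryCofan.IsColimit.hom_ext (complIsColimit t)
  · change t ≫ _ = t ≫ _
    rw [t_ι_twistMap_assoc, t_ι_twistMap, t_ι_twistMap, add_assoc]
  · change complHom t ≫ _ = complHom t ≫ _
    rw [compl_ι_twistMap_assoc, compl_ι_twistMap, compl_ι_twistMap]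

/-- The twist by `0` is the identity. [cite: MochizukiSemiAnbd2006, Prop. 2.6 p.29] -/
theorem twistMap_zero : twistMap t M 0 = 𝟙 _ := by
  apply Sigma.hom_ext
  intro i
  apply BinaryCofan.IsColimit.hom_ext (complIsColimit t)
  · change t ≫ _ = t ≫ _
    rw [t_ι_twistMap, add_zero, Category.comp_id]
  · change complHom t ≫ _ = complHom t ≫ _
    rw [compl_ι_twistMap, Category.comp_id]

/-- The twist automorphism of `∐_{ℤ/M} X`: `+1` on the `T`-summands. [cite: MochizukiSemiAnbd2006, Prop. 2.6 p.29] -/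
noncomputable def twistAut : (∐ fun _ : ZMod M => X) ≅ ∐ fun _ : ZMod M => X where
  hom := twistMap t M 1
  inv := twistMap t M (-1)
  hom_inv_id := by rw [twistMap_comp, add_neg_cancel, twistMap_zero]
  inv_hom_id := by rw [twistMap_comp, neg_add_cancel, twistMap_zero]

end TwistedCovering

namespace SemiGraphOfAnabelioids

variable (𝒢 : SemiGraphOfAnabelioids.{v₁, u₁, u}) (A : 𝒢.BObj) (b₀ : 𝒢.graph.Branch)
  {Q : 𝒢.E (𝒢.graph.edgeOf b₀)} (q : Q ⟶ A.T (𝒢.graph.edgeOf b₀)) [Mono q] (M : ℕ) [NeZero M]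

open Classical in
/-- The extra factor of the gluing of the twisted object at a branch `c`: the twist at `b₀`, the
identity elsewhere. [cite: MochizukiSemiAnbd2006, Prop. 2.6 p.29] -/
noncomputable def twistFam (c : 𝒢.graph.Branch) :
    (∐ fun _ : ZMod M => A.T (𝒢.graph.edgeOf c)) ≅ ∐ fun _ : ZMod M => A.T (𝒢.graph.edgeOf c) :=
  Function.update (fun c' : 𝒢.graph.Branch =>
    Iso.refl (∐ fun _ : ZMod M => A.T (𝒢.graph.edgeOf c'))) b₀ (TwistedCovering.twistAut q M) c

/-- At the twisted branch the extra factor is the twist automorphism. [cite: MochizukiSemiAnbd2006, Prop. 2.6 p.29] -/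
theorem twistFam_self : 𝒢.twistFam A b₀ q M b₀ = TwistedCovering.twistAut q M := by
  classical
  simp [twistFam]

/-- Away from the twisted branch the extra factor is the identity. [cite: MochizukiSemiAnbd2006, Prop. 2.6 p.29] -/
theorem twistFam_of_ne {c : 𝒢.graph.Branch} (hc : c ≠ b₀) : 𝒢.twistFam A b₀ q M c = Iso.refl _ := by
  classical
  simp [twistFam, Function.update_of_ne hc]

/-- The untwisted gluing `c^*(∐ S_v) ≅ ∐ c^* S_v ≅ ∐ T_e` of `ℤ/M` copies of `A`. [cite: MochizukiSemiAnbd2006, Prop. 2.6 p.29] -/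
noncomputable def canGluing (c : 𝒢.graph.Branch) (v : 𝒢.graph.Vertex)
    (h : 𝒢.graph.abuts c = some v) :
    (𝒢.pull c v h).pullback.obj (∐ fun _ : ZMod M => A.S v) ≅
      ∐ fun _ : ZMod M => A.T (𝒢.graph.edgeOf c) :=
  PreservesCoproduct.iso (𝒢.pull c v h).pullback _ ≪≫ Sigma.mapIso fun _ => A.ψ c v h

/-- The untwisted gluing takes the level-`i` copy of `c^* S_v` to the level-`i` copy of `T_e` through `ψ_c`. [cite: MochizukiSemiAnbd2006, Prop. 2.6 p.29] -/
@[reassoc]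
theorem map_ι_canGluing_hom (c : 𝒢.graph.Branch) (v : 𝒢.graph.Vertex)
    (h : 𝒢.graph.abuts c = some v) (i : ZMod M) :
    (𝒢.pull c v h).pullback.map (Sigma.ι (fun _ : ZMod M => A.S v) i) ≫
        (𝒢.canGluing A M c v h).hom =
      (A.ψ c v h).hom ≫ Sigma.ι (fun _ : ZMod M => A.T (𝒢.graph.edgeOf c)) i := by
  have h1 : (𝒢.pull c v h).pullback.map (Sigma.ι (fun _ : ZMod M => A.S v) i) ≫
      (PreservesCoproduct.iso (𝒢.pull c v h).pullback (fun _ : ZMod M => A.S v)).hom =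
      Sigma.ι (fun _ : ZMod M => (𝒢.pull c v h).pullback.obj (A.S v)) i := by
    rw [← ι_comp_sigmaComparison, Category.assoc, ← PreservesCoproduct.inv_hom, Iso.inv_hom_id,
      Category.comp_id]
  unfold canGluing
  rw [Iso.trans_hom, ← Category.assoc, h1, Sigma.ι_mapIso_hom]

/-- **The twisted object** `Z_M`: `ℤ/M` copies of `A`, glued as `A` is except at the branch `b₀`,
where the gluing is followed by the level shift `+1` on the summands `Q ⊆ T_{e(b₀)}`. [cite: MochizukiSemiAnbd2006, Prop. 2.6 p.29] -/
@[reducible] noncomputable def twistedObj : 𝒢.BObj where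
  S v := ∐ fun _ : ZMod M => A.S v
  T e := ∐ fun _ : ZMod M => A.T e
  ψ c v h := 𝒢.canGluing A M c v h ≪≫ 𝒢.twistFam A b₀ q M c

/-- The gluing of the twisted object on the level-`i` copy: `ψ_c`, then the level inclusion, then the extra factor at `c`. [cite: MochizukiSemiAnbd2006, Prop. 2.6 p.29] -/
@[reassoc]
theorem map_ι_twistedObj_ψ_hom (c : 𝒢.graph.Branch) (v : 𝒢.graph.Vertex)
    (h : 𝒢.graph.abuts c = some v) (i : ZMod M) :
    (𝒢.pull c v h).pullback.map (Sigma.ι (fun _ : ZMod M => A.S v) i) ≫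
        ((𝒢.twistedObj A b₀ q M).ψ c v h).hom =
      (A.ψ c v h).hom ≫ Sigma.ι (fun _ : ZMod M => A.T (𝒢.graph.edgeOf c)) i ≫
        (𝒢.twistFam A b₀ q M c).hom := by
  change _ ≫ (𝒢.canGluing A M c v h ≪≫ 𝒢.twistFam A b₀ q M c).hom = _
  rw [Iso.trans_hom, map_ι_canGluing_hom_assoc]

variable (K : 𝒢.graph.Subgraph) (hK : 𝒢.graph.edgeOf b₀ ∉ K.edges)

/-- Over a sub-semi-graph `𝕂` not containing the twisted edge, the level-`i` inclusion
`A|_𝕂 ⟶ Z_M|_𝕂` is a morphism of `B(𝒢_𝕂)`. [cite: MochizukiSemiAnbd2006, Prop. 2.6 p.29] -/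
noncomputable def levelIncl (i : ZMod M) :
    (𝒢.restrictFunctor K).obj A ⟶ (𝒢.restrictFunctor K).obj (𝒢.twistedObj A b₀ q M) where
  fS v := Sigma.ι (fun _ : ZMod M => A.S v.1) i
  fT e := Sigma.ι (fun _ : ZMod M => A.T e.1) i
  comm c v h := by
    have hc : c.1 ≠ b₀ := fun h' => hK (h' ▸ c.2)
    change (𝒢.pull c.1 v.1 _).pullback.map (Sigma.ι (fun _ : ZMod M => A.S v.1) i) ≫
      ((𝒢.twistedObj A b₀ q M).ψ c.1 v.1 _).hom =
      (A.ψ c.1 v.1 _).hom ≫ Sigma.ι (fun _ : ZMod M => A.T (𝒢.graph.edgeOf c.1)) i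
    rw [map_ι_twistedObj_ψ_hom, 𝒢.twistFam_of_ne A b₀ q M hc, Iso.refl_hom, Category.comp_id]

/-- The level inclusions on vertex constituents are the coproduct inclusions. [cite: MochizukiSemiAnbd2006, Prop. 2.6 p.29] -/
theorem levelIncl_fS (i : ZMod M) (v : K.toSemiGraph.Vertex) :
    (𝒢.levelIncl A b₀ q M K hK i).fS v = Sigma.ι (fun _ : ZMod M => A.S v.1) i := rfl

end SemiGraphOfAnabelioids

end Literature.AnabelianGeometry.SemiGraphs

namespace Literature.AnabelianGeometry.SemiGraphs

open CategoryTheory CategoryTheory.Limits CategoryTheory.PreGaloisCategory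
open Literature.AnabelianGeometry.Anabelioids

universe w v₁ u₁ u

namespace TwistedCovering

section tools

variable {C : Type u₁} [Category.{v₁} C] [PreGaloisCategory C] (F : C ⥤ FintypeCat.{w})
  [FiberFunctor F]

/-- Every point of the fibre of a finite coproduct lies in (the image of) a summand. [cite: SGA1, Exp. V §5] -/
theorem exists_eq_map_ι {J : Type} [Finite J] (f : J → C) (x : F.obj (∐ f)) :
    ∃ (j : J) (y : F.obj (f j)), F.map (Sigma.ι f j) y = x := by
  obtain ⟨⟨j⟩, y, h⟩ := Concrete.isColimit_exists_rep (Discrete.functor f ⋙ F)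
    (isColimitOfPreserves F (coproductIsCoproduct f)) x
  exact ⟨j, y, h⟩

/-- **Lifting along a mono from a connected object**: if `P` is connected, `m : W ↪ X` is a mono
and `u : P ⟶ X` meets the image of `m` in the fibre, then `u` factors through `m`. [cite: SGA1, Exp. V §5] -/
theorem exists_lift_of_mono {P W X : C} (hP : IsConnected P) (m : W ⟶ X) (hm : Mono m)
    (u : P ⟶ X) (p : F.obj P) (x : F.obj W) (h : F.map m x = F.map u p) :
    ∃ g : P ⟶ W, g ≫ m = u := by
  let y : F.obj (pullback u m) := (fiberPullbackEquiv F u m).symm ⟨(p, x), h.symm⟩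
  have hn : IsInitial (pullback u m) → False := not_initial_of_inhabited F y
  haveI : IsIso (pullback.fst u m) := IsConnected.noTrivialComponent _ (pullback.fst u m) hn
  refine ⟨inv (pullback.fst u m) ≫ pullback.snd u m, ?_⟩
  rw [Category.assoc, ← pullback.condition, IsIso.inv_hom_id_assoc]

end tools

section levels

variable {C : Type u₁} [Category.{v₁} C] [GaloisCategory C] (F : C ⥤ FintypeCat.{w})
  [FiberFunctor F]

/-- Distinct levels give distinct fibre points: `F(ι_i)(a) = F(ι_j)(a')` forces `i = j`. [cite: SGA1, Exp. V §5] -/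
theorem level_eq_of_map_ι_eq {J : Type} [Finite J] (X : C) {i j : J} {a a' : F.obj X}
    (h : F.map (Sigma.ι (fun _ : J => X) i) a = F.map (Sigma.ι (fun _ : J => X) j) a') :
    i = j := by
  -- push forward to `∐_J 1` and use that distinct sheets have distinct fibre points
  have key : ∀ (k : J) (b : F.obj X),
      F.map (Limits.Sigma.map fun _ : J => terminal.from X) (F.map (Sigma.ι (fun _ : J => X) k) b) =
        F.map (Sigma.ι (fun _ : J => ⊤_ C) k) (F.map (terminal.from X) b) := by
    intro k b
    rw [← FintypeCat.comp_apply, ← F.map_comp, Limits.Sigma.ι_map, F.map_comp,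
      FintypeCat.comp_apply]
  have h2 := congrArg (F.map (Limits.Sigma.map fun _ : J => terminal.from X)) h
  have ht : F.map (terminal.from X) a' = F.map (terminal.from X) a := by
    obtain ⟨e⟩ := nonempty_equiv_fiber_terminal_punit F
    exact e.injective (Subsingleton.elim _ _)
  rw [key, key, ht] at h2
  exact TrivialObj.map_ι_injective F (F.map (terminal.from X) a) h2

end levels

section count

open MulAction

/-- **Orbit count**: if `Q.relIndex P ≠ 0` then `|P·x₀| ≤ [P : P ∩ Q] · |Q·x₀|`. [cite: MochizukiSemiAnbd2006, Prop. 2.6 p.29] -/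
theorem card_orbit_le_relIndex_mul {G X : Type*} [Group G] [MulAction G X] [Finite X]
    (P Q : Subgroup G) (x₀ : X) (hn : Q.relIndex P ≠ 0) :
    Nat.card (orbit P x₀) ≤ Q.relIndex P * Nat.card (orbit Q x₀) := by
  classical
  let D : Subgroup P := Q.subgroupOf P
  haveI : D.FiniteIndex := ⟨hn⟩
  haveI : Finite (P ⧸ D) := Subgroup.finite_quotient_of_finiteIndex
  let Ψ : (P ⧸ D) × orbit Q x₀ → X := fun c => (c.1.out : G) • (c.2 : X)
  have hsub : orbit P x₀ ⊆ Set.range Ψ := by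
    rintro _ ⟨p, rfl⟩
    obtain ⟨h, hh⟩ := QuotientGroup.mk_out_eq_mul D p
    have hmem : ((h : P) : G)⁻¹ ∈ Q := by
      have := h.2
      rw [Subgroup.mem_subgroupOf] at this
      exact Q.inv_mem this
    refine ⟨⟨(p : P ⧸ D), ⟨((h : P) : G)⁻¹ • x₀, ⟨⟨_, hmem⟩, rfl⟩⟩⟩, ?_⟩
    change ((QuotientGroup.mk p : P ⧸ D).out : G) • ((h : P) : G)⁻¹ • x₀ = (p : G) • x₀
    rw [hh, Subgroup.coe_mul, mul_smul, smul_inv_smul]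
  calc Nat.card (orbit P x₀)
      ≤ Nat.card (Set.range Ψ) := Nat.card_mono (Set.toFinite _) hsub
    _ ≤ Nat.card ((P ⧸ D) × orbit Q x₀) :=
        Nat.card_le_card_of_surjective _ Set.rangeFactorization_surjective
    _ = Q.relIndex P * Nat.card (orbit Q x₀) := by
        rw [Nat.card_prod]; rfl

end count

end TwistedCovering

end Literature.AnabelianGeometry.SemiGraphs

namespace Literature.AnabelianGeometry.SemiGraphs

open CategoryTheory CategoryTheory.Limits CategoryTheory.PreGaloisCategory
open Literature.AnabelianGeometry.Anabelioids
open scoped Pointwise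

universe w v₁ u₁ u

namespace TwistedCovering

open MulAction

/-- Transport of an orbit bound along an isomorphism of basepoints and a conjugation: if every
orbit of `π(Γ) ⊆ Aut Φ'` on `Φ'(X)` has at most `d` points, so does every orbit of
`g · α(π(Γ)) · g⁻¹ ⊆ Aut Φ` on `Φ(X)`. [cite: MochizukiSemiAnbd2006, Prop. 2.6 p.29] -/
theorem card_orbit_conj_le {D : Type u₁} [Category.{v₁} D] {Φ Φ' : D ⥤ FintypeCat.{w}}
    (α : Φ' ≅ Φ) {Γ : Type*} [Group Γ] (π : Γ →* Aut Φ') (X : D) (d : ℕ)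
    (hd : ∀ x' : Φ'.obj X, Nat.card (orbit π.range x') ≤ d) (g : Aut Φ) (x : Φ.obj X) :
    Nat.card (orbit (↥(ConjAct.toConjAct g • ((Aut.autMulEquivOfIso α).toMonoidHom.comp π).range))
      x) ≤ d := by
  classical
  set R := ConjAct.toConjAct g • ((Aut.autMulEquivOfIso α).toMonoidHom.comp π).range with hR
  let x' : Φ'.obj X := α.inv.app X (g⁻¹ • x)
  have hx' : α.hom.app X x' = g⁻¹ • x := by
    change (α.inv.app X ≫ α.hom.app X) (g⁻¹ • x) = g⁻¹ • x
    rw [Iso.inv_hom_id_app]; rfl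
  -- every point of the `R`-orbit of `x` is `g · α(y)` for `y` in the `π(Γ)`-orbit of `x'`
  have hsub : orbit R x ⊆ (fun y : Φ'.obj X => g • α.hom.app X y) '' orbit π.range x' := by
    rintro _ ⟨⟨r, hr⟩, rfl⟩
    rw [hR, Subgroup.mem_pointwise_smul_iff_inv_smul_mem] at hr
    obtain ⟨γ, hγ⟩ := hr
    refine ⟨π γ • x', ⟨⟨π γ, ⟨γ, rfl⟩⟩, rfl⟩, ?_⟩
    change g • α.hom.app X (π γ • x') = r • x
    have h1 : (Aut.autMulEquivOfIso α) (π γ) = (ConjAct.toConjAct g)⁻¹ • r := by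
      rw [← hγ]; rfl
    have h2 : (Aut.autMulEquivOfIso α) (π γ) = α.conjAut (π γ) := rfl
    have h3 : α.conjAut (π γ) • α.hom.app X x' = α.hom.app X (π γ • x') := by
      rw [PreGaloisCategory.mulAction_def, PreGaloisCategory.mulAction_def, Iso.conjAut_hom,
        Iso.conj_apply, NatTrans.comp_app, NatTrans.comp_app, FintypeCat.comp_apply,
        FintypeCat.comp_apply, ← FintypeCat.comp_apply (α.hom.app X) (α.inv.app X),
        α.hom_inv_id_app, FintypeCat.id_apply]
    rw [← h3, ← h2, h1, hx', ← map_inv, ConjAct.smul_def, ConjAct.ofConjAct_toConjAct, inv_inv,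
      mul_smul, mul_smul, smul_inv_smul, smul_inv_smul]
  calc Nat.card (orbit R x)
      ≤ Nat.card ((fun y : Φ'.obj X => g • α.hom.app X y) '' orbit π.range x') :=
        Nat.card_mono (Set.toFinite _) hsub
    _ ≤ Nat.card (orbit π.range x') := Nat.card_image_le (Set.toFinite _)
    _ ≤ d := hd x'

end TwistedCovering

namespace SemiGraphOfAnabelioids

open MulAction

variable (𝒢 : SemiGraphOfAnabelioids.{v₁, u₁, u}) (A : 𝒢.BObj) (b₀ : 𝒢.graph.Branch)
  {Q : 𝒢.E (𝒢.graph.edgeOf b₀)} (q : Q ⟶ A.T (𝒢.graph.edgeOf b₀)) [Mono q] (M : ℕ) [NeZero M]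
  (K : 𝒢.graph.Subgraph)

/-- **`𝕂`-side of the descent**: `Π_𝕂` preserves the levels of the twisted object (the edge of
the twist is not in `𝕂`), so every `Π_𝕂`-orbit on `F'(Z_M)_{w'}` has at most `deg_{w'} A` points. [cite: MochizukiSemiAnbd2006, Prop. 2.6 p.29] -/
theorem card_orbit_piK_twistedObj_le (hK : 𝒢.graph.edgeOf b₀ ∉ K.edges) (w' : K.toSemiGraph.Vertex)
    (F' : 𝒢.V w'.1 ⥤ FintypeCat.{w})
    [FiberFunctor F'] (x : (𝒢.ρ w'.1 ⋙ F').obj (𝒢.twistedObj A b₀ q M)) :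
    Nat.card (orbit (𝒢.piHToPi K w' F').range x) ≤ Nat.card (F'.obj (A.S w'.1)) := by
  classical
  obtain ⟨i, a, hx⟩ := TwistedCovering.exists_eq_map_ι F' (fun _ : ZMod M => A.S w'.1) x
  have hsub : orbit (𝒢.piHToPi K w' F').range x
      ⊆ Set.range (F'.map (Sigma.ι (fun _ : ZMod M => A.S w'.1) i)) := by
    rintro _ ⟨⟨_, ⟨k, rfl⟩⟩, rfl⟩
    change (𝒢.piHToPi K w' F' k) • x ∈ Set.range _
    refine ⟨(𝒢.piHToPi K w' F' k).hom.app A a, ?_⟩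
    rw [← hx]
    exact (mulAction_naturality ((𝒢.restrict K).ρ w' ⋙ F') k (𝒢.levelIncl A b₀ q M K hK i) a).symm
  calc Nat.card (orbit (𝒢.piHToPi K w' F').range x)
      ≤ Nat.card (Set.range (F'.map (Sigma.ι (fun _ : ZMod M => A.S w'.1) i))) :=
        Nat.card_mono (Set.toFinite _) hsub
    _ ≤ Nat.card (F'.obj (A.S w'.1)) :=
        Nat.card_le_card_of_surjective _ Set.rangeFactorization_surjective

end SemiGraphOfAnabelioids

end Literature.AnabelianGeometry.SemiGraphs
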